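import Literature.Analysis.FluidPDE.RestrictedEulerDynamics
import HarnessLib

/-!
# The axisymmetric centre germ is never triaxial (Negative lane, supports `RungBlowupCofinal` / BC5 rung 2)

Kernel form of the clause «an `axi` CANDIDATE has an AXIS-TYPE germ — NOT an instance shape for
`HalfTurnForwardBlowup 2`» (case Z2-HT PREREG v1.1 §5; `Cruxes/RungBlowupCofinal/Lines/halfturn.lean` v4,
`IsTriaxial`).  In the half-turn cell at rung `2` the centre velocity gradient of a profile is
`∇U(0) = 3𝒜(0) + B(0)[e₃]ₓ`; on the axisymmetric sub-cell (`p = q = 0`) this is the matrix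

  `G(m, b) = !![3m, −b, 0; b, 3m, 0; 0, 0, −6m]`,

whose strain germ `½(G + Gᵀ) − (tr G / 3)·1 = diag(3m, 3m, −6m)` has a REPEATED eigenvalue, so the
restricted-Euler discriminant `D = Q³ + (27/4)R²` of the germ vanishes (`discr_diagonal_fin_three`), whereas the
triaxiality letter `IsTriaxial η M := 0 < tr(MᵀM) ∧ D(strain germ of M) ≤ −η·(tr MᵀM)³` demands `D < 0` as soon
as `η > 0` and `M ≠ 0`.  Hence NO axisymmetric germ satisfies the letter, for any floor `η > 0` — stated here on
the unfolded letter (the Lines file is not an importable module): with `hG : G = G(m, b)` the last theorem is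
definitionally `¬ IsTriaxial η G`.

Nothing in this file asserts a Theses declaration; it records which census sector can feed the rung's germ clause.
-/

namespace Summit.NavierStokesRegularity.RungBlowupCofinalAxisymmetricGerm

open Matrix Literature.Analysis.FluidPDE

/-- The axisymmetric germ is trace-free (incompressibility at the centre). -/
theorem trace_axisymmetricGerm (m b : ℝ) {G : Matrix (Fin 3) (Fin 3) ℝ}
    (hG : G = !![3 * m, -b, 0; b, 3 * m, 0; 0, 0, -6 * m]) : G.trace = 0 := by
  subst hG
  rw [Matrix.trace_fin_three]
  simp
  ring

/-- The strain germ of the axisymmetric centre gradient is `diag(3m, 3m, −6m)`: the swirl `b` drops out. -/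
theorem strainGerm_axisymmetric (m b : ℝ) {G : Matrix (Fin 3) (Fin 3) ℝ}
    (hG : G = !![3 * m, -b, 0; b, 3 * m, 0; 0, 0, -6 * m]) :
    (1 / 2 : ℝ) • (G + Gᵀ) - (G.trace / 3) • (1 : Matrix (Fin 3) (Fin 3) ℝ) =
      Matrix.diagonal ![3 * m, 3 * m, -6 * m] := by
  rw [trace_axisymmetricGerm m b hG, zero_div, zero_smul, sub_zero]
  subst hG
  ext i j
  simp only [Matrix.smul_apply, Matrix.add_apply, Matrix.transpose_apply, smul_eq_mul]
  fin_cases i <;> fin_cases j <;> simp only [Fin.isValue, Fin.zero_eta, Fin.mk_one, Fin.reduceFinMk] <;> simp <;> ring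

/-- **The discriminant of the axisymmetric strain germ vanishes** (repeated eigenvalue `3m`). -/
theorem discr_strainGerm_axisymmetric (m b : ℝ) {G : Matrix (Fin 3) (Fin 3) ℝ}
    (hG : G = !![3 * m, -b, 0; b, 3 * m, 0; 0, 0, -6 * m]) :
    VelocityGradient.discr ((1 / 2 : ℝ) • (G + Gᵀ) - (G.trace / 3) • (1 : Matrix (Fin 3) (Fin 3) ℝ)) = 0 := by
  rw [strainGerm_axisymmetric m b hG]
  have hl : (![3 * m, 3 * m, -6 * m] : Fin 3 → ℝ) 0 + (![3 * m, 3 * m, -6 * m] : Fin 3 → ℝ) 1 +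
      (![3 * m, 3 * m, -6 * m] : Fin 3 → ℝ) 2 = 0 := by
    simp
    ring
  rw [VelocityGradient.discr_diagonal_fin_three _ hl]
  simp

/-- `tr(GᵀG) = 54m² + 2b²` for the axisymmetric germ (its Frobenius norm squared). -/
theorem trace_transpose_mul_axisymmetricGerm (m b : ℝ) {G : Matrix (Fin 3) (Fin 3) ℝ}
    (hG : G = !![3 * m, -b, 0; b, 3 * m, 0; 0, 0, -6 * m]) :
    (Gᵀ * G).trace = 54 * m ^ 2 + 2 * b ^ 2 := by
  subst hG
  rw [Matrix.trace_fin_three]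
  simp [Matrix.mul_apply, Fin.sum_univ_three]
  ring

/-- **No axisymmetric centre germ is triaxial, for any floor `η > 0`** — with `hG : G = G(m, b)` this is the
unfolded instance `¬ IsTriaxial η G` of the half-turn rung's triaxiality letter
`IsTriaxial η M := 0 < tr(MᵀM) ∧ discr(½(M + Mᵀ) − (tr M/3)·1) ≤ −η·(tr MᵀM)³`: the left side of the
inequality is `0` (`discr_strainGerm_axisymmetric`) while the right side is `< 0` once `tr(GᵀG) > 0`.
So the `axi` census sector (and every profile axisymmetric about `e₃`) can never instance the rung's germ
clause; only the `strain`/`full` sectors (`|π₀| ∉ {0, 3|m₀|}`) can. -/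
theorem not_triaxialLetter_axisymmetricGerm {η : ℝ} (hη : 0 < η) (m b : ℝ) {G : Matrix (Fin 3) (Fin 3) ℝ}
    (hG : G = !![3 * m, -b, 0; b, 3 * m, 0; 0, 0, -6 * m]) :
    ¬ (0 < (Gᵀ * G).trace ∧
        VelocityGradient.discr ((1 / 2 : ℝ) • (G + Gᵀ) - (G.trace / 3) • (1 : Matrix (Fin 3) (Fin 3) ℝ)) ≤
          -η * ((Gᵀ * G).trace) ^ 3) := by
  rintro ⟨hpos, hle⟩
  rw [discr_strainGerm_axisymmetric m b hG] at hle
  have h3 : 0 < ((Gᵀ * G).trace) ^ 3 := pow_pos hpos 3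
  nlinarith

/-- The non-degenerate case made explicit: for `(m, b) ≠ (0, 0)` the Frobenius clause HOLDS and it is the
discriminant clause that fails — the germ is a genuine non-zero AXIS-TYPE germ, not a zero germ. -/
theorem trace_transpose_mul_axisymmetricGerm_pos {m b : ℝ} (h : m ≠ 0 ∨ b ≠ 0) {G : Matrix (Fin 3) (Fin 3) ℝ}
    (hG : G = !![3 * m, -b, 0; b, 3 * m, 0; 0, 0, -6 * m]) : 0 < (Gᵀ * G).trace := by
  rw [trace_transpose_mul_axisymmetricGerm m b hG]
  rcases h with h | h
  · have := sq_pos_of_ne_zero h  -- 0 < m ^ 2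
    positivity
  · have := sq_pos_of_ne_zero h
    positivity

end Summit.NavierStokesRegularity.RungBlowupCofinalAxisymmetricGerm
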